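import Summits.BirchSwinnertonDyer.BirchSwinnertonDyer.Theses.KatoDescentTamePotSupersingular
import Summits.BirchSwinnertonDyer.BirchSwinnertonDyer.Theorems.KatoDescentPotSupersingularReducibleUpperOfCountInputsNodes
import Summits.BirchSwinnertonDyer.Rank1Residual.Additive.X4RankZeroKatoBoundTamagawaExact
import Summits.BirchSwinnertonDyer.Rank1Residual.Additive.QuadraticTwistBSDComparisonIsogeny
import Literature.NumberTheory.EllipticCurves.BSDShaProofs
import HarnessLib

/-!
# Route `KatoDescentTamePotSupersingular` (rung K8-t′, cell `bsd-potss`), crux L₀ `TameLowerHalfRankZero`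
# (item stmt-BirchSwinnertonDyer-19981) / open core `TameLowerIntrinsicNonCM` (item 19618):
# the PARITY SHADOW of the tame crux — (t′) twin of `KatoDescentPotSupersingularWildLowerParity.lean`
# (a `--supports stmt-BirchSwinnertonDyer-19618` helper file; closes NOTHING class-wide)

PARTITION (D-0054, cell bsd-potss): EXCLUDED-DOMAIN non-CM additive `p` · B4 (t′) (`e ∈ {3,4,6}`, odd `p`),
`r_an = 0`, LOWER half L₀ — types a NECESSARY CONDITION of the tame crux (strength) and a descent-free
FALSIFIER; shrinks-literal none.  Courtesy twin filed by the K9 seat `bsd-potss-k9-c2` (generation 7).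

On the (t′) rows where the UPPER half is a theorem modulo named inputs — every REDUCIBLE row
(`ReducibleUpperOfCountInputs.tameUpperReducibleDefect_body`'s engine
`missingUpperBoundAt_of_memberCountInputs`, kmc Part 16; the KT glue 19712 is closed on it) and every
IRREDUCIBLE row with `p`-adic tower onto (`X4RankZero.missingUpperBoundAt_of_katoTam`, A161″) — the tame
crux forces `ord_p #Ш_an(W)` EVEN (the crux + the upper half give `ord_p #Ш_an = ord_p #Ш`, a square by
Cassels–Tate), and ONE such row with ODD `ord_p #Ш_an` (read at any member of its class, by
`K9Parity.even_padicValRat_shaAn_sub_of_isIsogenous`) refutes it.  The route-free parity lemmas are those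
of the wild file (`K9Parity.*`).  HONEST FRAMING: BSD is not advanced; the tame core 19618 (Kato 12.10
lower inclusion at a tame additive potentially supersingular prime) stays open; everything is CONDITIONAL
on the displayed named facts; THEOREMS ONLY.

RE-POINT (seat `bsd-potss-k8t-c2` generation 8, 2026-08-26; gate lint `theses-cone`): the public statements of
this file are BYTE-IDENTICAL to p463170; only the import of the K9 module
`Theorems.KatoDescentPotSupersingularWildLowerParity` (which imports the K9 ROUTE file, so that every K9 route
edit rebuilt this KT file) is replaced by its route-free inputs
(`Theorems.KatoDescentPotSupersingularReducibleUpperOfCountInputsNodes`,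
`Rank1Residual.Additive.X4RankZeroKatoBoundTamagawaExact`, `Rank1Residual.Additive.QuadraticTwistBSDComparisonIsogeny`,
`Literature.….BSDShaProofs`) plus §0 below: PRIVATE local copies of the two route-free `K9Parity` parity
lemmas the proofs use (`…_of_lower_of_upper`, `…_sub_of_isIsogenous`; proofs verbatim, names suffixed
`_local`, not exported — the public originals stay in the K9 file, no restatement is landed).  Only this file's
own route file remains in its module cone.

References: [SilvermanAEC2009] Thm. X.4.14; [Cassels1965ArithmeticVIII]; [Kato2004Asterisque] Conj. 12.10
(p. 224), Thm. 14.5 (3) (p. 236), proof of Prop. 14.16 (pp. 244–245); [Miller2011LMS] Def. 1.1.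
-/

set_option autoImplicit false
-- sibling precedent (`KatoDescentPotSupersingularAssembly.lean`): the directory name repeats the summit name
set_option linter.dupNamespace false

noncomputable section

open scoped Classical

namespace Summit.BirchSwinnertonDyer.BirchSwinnertonDyer.Theorems

open WeierstrassCurve Literature.NumberTheory.EllipticCurves
  Literature.NumberTheory.EllipticCurves.ModularForms
  Literature.NumberTheory.EllipticCurves.Rank1Residual
  Literature.NumberTheory.EllipticCurves.Rank1Residual.Typed
  Summit.BirchSwinnertonDyer.Rank1Residual.Additive
  Summit.BirchSwinnertonDyer.Rank1Residual
  Summit.BirchSwinnertonDyer.BirchSwinnertonDyer.Theses.KatoDescentTamePotSupersingular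

/-! ## §0 Private local copies of the route-free parity lemmas (verbatim from
`KatoDescentPotSupersingularWildLowerParity.lean` §1, `K9Parity.*`; not exported) -/

section ParityLocal

variable (W : WeierstrassCurve ℚ) [W.IsElliptic] (p : ℕ) [Fact p.Prime]

/-- Local copy of `K9Parity.even_padicValNat_of_isSquare`: the `p`-adic valuation of a perfect square is
even. [folklore] -/
private theorem KTParity.even_padicValNat_of_isSquare_local {n : ℕ} (h : IsSquare n) :
    Even (padicValNat p n) := by
  obtain ⟨r, rfl⟩ := h
  rcases eq_or_ne r 0 with hr | hr
  · subst hr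
    simp
  · rw [padicValNat.mul hr hr]
    exact ⟨_, rfl⟩

/-- Local copy of `K9Parity.even_padicValNat_shaOrder`: `ord_p #Ш(E)` is even for finite `Ш`
(Cassels–Tate, tree theorem `isSquare_shaOrder_of_casselsTate` over the named fact
`exists_casselsTate_pairing`). [cite: SilvermanAEC2009, Thm. X.4.14] -/
private theorem KTParity.even_padicValNat_shaOrder_local (hCT : exists_casselsTate_pairing (K := ℚ))
    (hfin : W.ShaFinite) : Even (padicValNat p W.shaOrder) :=
  KTParity.even_padicValNat_of_isSquare_local p (isSquare_shaOrder_of_casselsTate hCT W hfin)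

/-- Local copy of `K9Parity.even_padicValRat_shaAn_of_lower_of_upper`: lower half + upper half + finite
`Ш` ⇒ every rational value of `#Ш_an(E)` has even `p`-adic valuation (`missingPPartAt_of_lower_of_upper`;
`#Ш` is a square). [cite: Miller2011LMS, Def. 1.1] [cite: SilvermanAEC2009, Thm. X.4.14] -/
private theorem KTParity.even_padicValRat_shaAn_of_lower_of_upper_local
    (hCT : exists_casselsTate_pairing (K := ℚ)) (hfin : W.ShaFinite) (hl : MissingLowerBoundAt W p)
    (hu : MissingUpperBoundAt W p) : ∀ q : ℚ, shaAn W = (q : ℂ) → Even (padicValRat p q) := by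
  intro q hq
  obtain ⟨q₀, hq₀, hv⟩ := missingPPartAt_of_lower_of_upper W p hl hu
  have hqq : q = q₀ := by exact_mod_cast hq.symm.trans hq₀
  subst hqq
  obtain ⟨k, hk⟩ := KTParity.even_padicValNat_shaOrder_local W p hCT hfin
  refine ⟨(k : ℤ), ?_⟩
  rw [hv, hk]
  omega

/-- Local copy of `K9Parity.even_padicValRat_shaAn_sub_of_isIsogenous`: `ord_p #Ш_an mod 2` is a
`ℚ`-isogeny invariant on globally minimal models (Cassels' defect identity
`TwistComparison.defectAgreeAt_of_isIsogenous` over Cassels `hCassels` and modularity `hmod`, with `#Ш(W)`,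
`#Ш(W')` both squares by Cassels–Tate `hCT`). [cite: Cassels1965ArithmeticVIII]
[cite: MilneADT2006, Thm. I.7.3] [cite: SilvermanAEC2009, Thm. X.4.14] -/
private theorem KTParity.even_padicValRat_shaAn_sub_of_isIsogenous_local
    (hCassels : bsdRHS_eq_of_isIsogenous) (hmod : hasEntireLFunction_rat)
    (hCT : exists_casselsTate_pairing (K := ℚ)) (W' : WeierstrassCurve ℚ) [W'.IsElliptic]
    [W.IsGloballyMinimal] [W'.IsGloballyMinimal] (hiso : IsIsogenous W W') (hfin : W.ShaFinite)
    {q q' : ℚ} (hq : shaAn W = (q : ℂ)) (hq' : shaAn W' = (q' : ℂ)) :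
    Even (padicValRat p q - padicValRat p q') := by
  obtain ⟨hfin', -⟩ := hCassels W W' hiso hfin
  obtain ⟨q₁, q₁', hq₁, hq₁', hdef⟩ :=
    TwistComparison.defectAgreeAt_of_isIsogenous W W' p hCassels hmod hiso hfin hq
  have h1 : q₁ = q := by exact_mod_cast hq₁.symm.trans hq
  have h2 : q₁' = q' := by exact_mod_cast hq₁'.symm.trans hq'
  subst h1 h2
  obtain ⟨a, ha⟩ := KTParity.even_padicValNat_shaOrder_local W p hCT hfin
  obtain ⟨b, hb⟩ := KTParity.even_padicValNat_shaOrder_local W' p hCT hfin'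
  refine ⟨(a : ℤ) - b, ?_⟩
  have hdef' : padicValRat p q₁ - padicValRat p q₁' =
      (padicValNat p W.shaOrder : ℤ) - (padicValNat p W'.shaOrder : ℤ) := by linarith
  rw [hdef', ha, hb]
  omega

end ParityLocal

/-- **L₀ at a REDUCIBLE (t′) row ⇒ `ord_p #Ш_an` even** (odd `p`, `Addv`, `SubTprime`, `W[p]` reducible,
`r_an = 0`): upper half by `ReducibleUpperOfCountInputs.missingUpperBoundAt_of_memberCountInputs` (mod
Kato's `𝐇¹` data, modularity, Kato's sharp member count, Cassels, GZK), evenness by Cassels–Tate.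
Conditional; nothing asserted.
[cite: Kato2004Asterisque, proof of Prop. 14.16 (pp. 244–245)] [cite: SilvermanAEC2009, Thm. X.4.14] -/
theorem KTParity.even_padicValRat_shaAn_tame_red_of_lower (hne : Kato2004.nonempty_iwasawaH1Data)
    (hmodN : exists_isNewformOf) (hin : Kato2004.exists_memberHullCountInputs)
    (hCassels : bsdRHS_eq_of_isIsogenous) (hGZK : rank_eq_analyticRank_of_analyticRank_le_one)
    (hmodL : hasEntireLFunction_rat) (hCT : exists_casselsTate_pairing (K := ℚ))
    (W : WeierstrassCurve ℚ) [W.IsElliptic] [W.IsGloballyMinimal] (p : ℕ) [Fact p.Prime]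
    (hr : W.analyticRank = 0) (hp : p ≠ 2) (hadd : Addv W p) (hT : SubTprime W p) (hred : ¬ Irr W p)
    (hl : MissingLowerBoundAt W p) : ∀ q : ℚ, shaAn W = (q : ℂ) → Even (padicValRat p q) := by
  have hfin : W.ShaFinite := (hGZK W (by rw [hr]; exact zero_le_one)).2
  have hO5 : ClassO5 W p := ⟨hp, hadd, Or.inr hT⟩
  have hu : MissingUpperBoundAt W p :=
    ReducibleUpperOfCountInputs.missingUpperBoundAt_of_memberCountInputs hne hmodN hin hCassels hGZK
      hmodL W p hp hadd.1 hadd.2 hO5.padicValRat_j_nonneg hred hr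
  exact KTParity.even_padicValRat_shaAn_of_lower_of_upper_local W p hCT hfin hl hu

/-- **L₀ at an IRREDUCIBLE (t′) row with `p`-adic tower onto ⇒ `ord_p #Ш_an` even**: upper half by
`X4RankZero.missingUpperBoundAt_of_katoTam` (A161″, GZK, modularity), evenness by Cassels–Tate.
Conditional; nothing asserted.
[cite: Kato2004Asterisque, Thm. 14.5 (3) (p. 236), (12.5.2) (p. 222)] [cite: SilvermanAEC2009, Thm. X.4.14] -/
theorem KTParity.even_padicValRat_shaAn_tame_towerSurj_of_lower
    (hKatoT : Kato2004.rankZero_padicValNat_sha_add_padicValNat_tamagawa_le_of_additive_potGood_of_imageContainsSL2)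
    (hGZK : rank_eq_analyticRank_of_analyticRank_le_one) (hmodL : hasEntireLFunction_rat)
    (hCT : exists_casselsTate_pairing (K := ℚ))
    (W : WeierstrassCurve ℚ) [W.IsElliptic] [W.IsGloballyMinimal] (p : ℕ) [Fact p.Prime]
    (hr : W.analyticRank = 0) (hp : p ≠ 2) (hadd : Addv W p) (hT : SubTprime W p) (hirr : Irr W p)
    (hsurj : ∀ n : ℕ, W.HasSurjectiveModNGaloisRep (p ^ n : ℕ)) (hl : MissingLowerBoundAt W p) :
    ∀ q : ℚ, shaAn W = (q : ℂ) → Even (padicValRat p q) := by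
  have hfin : W.ShaFinite := (hGZK W (by rw [hr]; exact zero_le_one)).2
  have hO5 : ClassO5 W p := ⟨hp, hadd, Or.inr hT⟩
  have hu : MissingUpperBoundAt W p :=
    X4RankZero.missingUpperBoundAt_of_katoTam W p hKatoT hGZK hmodL hr ⟨hp, hadd, hirr⟩
      hO5.padicValRat_j_nonneg hsurj
  exact KTParity.even_padicValRat_shaAn_of_lower_of_upper_local W p hCT hfin hl hu

/-- **THE PARITY SHADOW OF THE TAME CRUX (reducible rows)**: `TameLowerHalfRankZero` (item 19981) implies,
modulo the U₀-red inputs and Cassels–Tate, that `ord_p #Ш_an(W)` is EVEN at every globally minimal (t′)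
`r_an = 0` curve with `W[p]` reducible.  STRENGTH record; conditional; the item is NOT closed.
[cite: Kato2004Asterisque, Conj. 12.10 (p. 224), proof of Prop. 14.16 (pp. 244–245)] [cite: SilvermanAEC2009, Thm. X.4.14] -/
theorem KTParity.even_padicValRat_shaAn_red_of_tameLowerHalfRankZero (hL : TameLowerHalfRankZero)
    (hne : Kato2004.nonempty_iwasawaH1Data) (hmodN : exists_isNewformOf)
    (hin : Kato2004.exists_memberHullCountInputs) (hCassels : bsdRHS_eq_of_isIsogenous)
    (hGZK : rank_eq_analyticRank_of_analyticRank_le_one) (hmodL : hasEntireLFunction_rat)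
    (hCT : exists_casselsTate_pairing (K := ℚ)) :
    ∀ (W : WeierstrassCurve ℚ) [W.IsElliptic] [W.IsGloballyMinimal] (p : ℕ) [Fact p.Prime],
      W.analyticRank = 0 → p ≠ 2 → Addv W p → SubTprime W p → ¬ Irr W p →
      ∀ q : ℚ, shaAn W = (q : ℂ) → Even (padicValRat p q) :=
  fun W _ _ p _ hr hp hadd hT hred ↦
    KTParity.even_padicValRat_shaAn_tame_red_of_lower hne hmodN hin hCassels hGZK hmodL hCT W p hr hp hadd
      hT hred (hL W p hr hp hadd hT)

/-- **THE PARITY SHADOW OF THE TAME CRUX (tower-onto irreducible rows)**: `TameLowerHalfRankZero`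
implies, modulo A161″, GZK, modularity and Cassels–Tate, that `ord_p #Ш_an(W)` is EVEN at every globally
minimal (t′) `r_an = 0` curve with `W[p]` irreducible and `p`-adic tower image onto.  STRENGTH record;
conditional; the item is NOT closed.
[cite: Kato2004Asterisque, Conj. 12.10 (p. 224), Thm. 14.5 (3) (p. 236)] [cite: SilvermanAEC2009, Thm. X.4.14] -/
theorem KTParity.even_padicValRat_shaAn_towerSurj_of_tameLowerHalfRankZero (hL : TameLowerHalfRankZero)
    (hKatoT : Kato2004.rankZero_padicValNat_sha_add_padicValNat_tamagawa_le_of_additive_potGood_of_imageContainsSL2)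
    (hGZK : rank_eq_analyticRank_of_analyticRank_le_one) (hmodL : hasEntireLFunction_rat)
    (hCT : exists_casselsTate_pairing (K := ℚ)) :
    ∀ (W : WeierstrassCurve ℚ) [W.IsElliptic] [W.IsGloballyMinimal] (p : ℕ) [Fact p.Prime],
      W.analyticRank = 0 → p ≠ 2 → Addv W p → SubTprime W p → Irr W p →
      (∀ n : ℕ, W.HasSurjectiveModNGaloisRep (p ^ n : ℕ)) →
      ∀ q : ℚ, shaAn W = (q : ℂ) → Even (padicValRat p q) :=
  fun W _ _ p _ hr hp hadd hT hirr hsurj ↦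
    KTParity.even_padicValRat_shaAn_tame_towerSurj_of_lower hKatoT hGZK hmodL hCT W p hr hp hadd hT hirr
      hsurj (hL W p hr hp hadd hT)

/-- **The same for the open core `TameLowerIntrinsicNonCM` (item 19618), reducible rows**.  STRENGTH
record; conditional; the item is NOT closed.
[cite: Kato2004Asterisque, Conj. 12.10 (p. 224), proof of Prop. 14.16 (pp. 244–245)] [cite: SilvermanAEC2009, Thm. X.4.14] -/
theorem KTParity.even_padicValRat_shaAn_red_of_tameLowerIntrinsicNonCM (hL : TameLowerIntrinsicNonCM)
    (hne : Kato2004.nonempty_iwasawaH1Data) (hmodN : exists_isNewformOf)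
    (hin : Kato2004.exists_memberHullCountInputs) (hCassels : bsdRHS_eq_of_isIsogenous)
    (hGZK : rank_eq_analyticRank_of_analyticRank_le_one) (hmodL : hasEntireLFunction_rat)
    (hCT : exists_casselsTate_pairing (K := ℚ)) :
    ∀ (W : WeierstrassCurve ℚ) [W.IsElliptic] [W.IsGloballyMinimal] (p : ℕ) [Fact p.Prime],
      W.analyticRank = 0 → p ≠ 2 → Addv W p → SubTprime W p → ¬ Irr W p → ¬ W.HasCM →
      (∀ (W' : WeierstrassCurve ℚ) [W'.IsElliptic] [W'.IsGloballyMinimal], IsIsogenous W W' →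
        ∀ q' : ℚ, shaAn W' = (q' : ℂ) → 0 < padicValRat p q') →
      ∀ q : ℚ, shaAn W = (q : ℂ) → Even (padicValRat p q) :=
  fun W _ _ p _ hr hp hadd hT hred hCM hI ↦
    KTParity.even_padicValRat_shaAn_tame_red_of_lower hne hmodN hin hCassels hGZK hmodL hCT W p hr hp hadd
      hT hred (hL W p hr hp hadd hT hCM hI)

/-- **KILL CRITERION (reducible (t′) rows)**: one globally minimal (t′) `r_an = 0` curve with `W[p]`
reducible and `#Ш_an(W) = q` of ODD `p`-adic valuation refutes `TameLowerHalfRankZero` (item 19981),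
modulo the U₀-red inputs and Cassels–Tate.  (BSD + Cassels–Tate predict no such curve.)  Conditional.
[cite: Kato2004Asterisque, proof of Prop. 14.16 (pp. 244–245)] [cite: SilvermanAEC2009, Thm. X.4.14] -/
theorem KTParity.not_tameLowerHalfRankZero_of_odd_red (hne : Kato2004.nonempty_iwasawaH1Data)
    (hmodN : exists_isNewformOf) (hin : Kato2004.exists_memberHullCountInputs)
    (hCassels : bsdRHS_eq_of_isIsogenous) (hGZK : rank_eq_analyticRank_of_analyticRank_le_one)
    (hmodL : hasEntireLFunction_rat) (hCT : exists_casselsTate_pairing (K := ℚ))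
    (W : WeierstrassCurve ℚ) [W.IsElliptic] [W.IsGloballyMinimal] (p : ℕ) [Fact p.Prime]
    (hr : W.analyticRank = 0) (hp : p ≠ 2) (hadd : Addv W p) (hT : SubTprime W p) (hred : ¬ Irr W p)
    {q : ℚ} (hq : shaAn W = (q : ℂ)) (hodd : Odd (padicValRat p q)) : ¬ TameLowerHalfRankZero :=
  fun hL ↦ Int.not_even_iff_odd.mpr hodd
    (KTParity.even_padicValRat_shaAn_red_of_tameLowerHalfRankZero hL hne hmodN hin hCassels hGZK hmodL
      hCT W p hr hp hadd hT hred q hq)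

/-- **KILL CRITERION (tower-onto irreducible (t′) rows)**: one globally minimal (t′) `r_an = 0` curve with
`W[p]` irreducible, `p`-adic tower onto and `#Ш_an(W) = q` of ODD `p`-adic valuation refutes
`TameLowerHalfRankZero`, modulo A161″, GZK, modularity and Cassels–Tate.  Conditional.
[cite: Kato2004Asterisque, Thm. 14.5 (3) (p. 236)] [cite: SilvermanAEC2009, Thm. X.4.14] -/
theorem KTParity.not_tameLowerHalfRankZero_of_odd_towerSurj
    (hKatoT : Kato2004.rankZero_padicValNat_sha_add_padicValNat_tamagawa_le_of_additive_potGood_of_imageContainsSL2)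
    (hGZK : rank_eq_analyticRank_of_analyticRank_le_one) (hmodL : hasEntireLFunction_rat)
    (hCT : exists_casselsTate_pairing (K := ℚ))
    (W : WeierstrassCurve ℚ) [W.IsElliptic] [W.IsGloballyMinimal] (p : ℕ) [Fact p.Prime]
    (hr : W.analyticRank = 0) (hp : p ≠ 2) (hadd : Addv W p) (hT : SubTprime W p) (hirr : Irr W p)
    (hsurj : ∀ n : ℕ, W.HasSurjectiveModNGaloisRep (p ^ n : ℕ)) {q : ℚ} (hq : shaAn W = (q : ℂ))
    (hodd : Odd (padicValRat p q)) : ¬ TameLowerHalfRankZero :=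
  fun hL ↦ Int.not_even_iff_odd.mpr hodd
    (KTParity.even_padicValRat_shaAn_towerSurj_of_tameLowerHalfRankZero hL hKatoT hGZK hmodL hCT W p hr hp
      hadd hT hirr hsurj q hq)

/-- **KILL CRITERION read at ANY member (reducible (t′) rows)**: odd `ord_p #Ш_an` at some globally minimal
`W' ∼_ℚ W` (parity is a class invariant, `K9Parity.even_padicValRat_shaAn_sub_of_isIsogenous`) refutes
`TameLowerHalfRankZero`, modulo the U₀-red inputs and Cassels–Tate.  Conditional.
[cite: Cassels1965ArithmeticVIII] [cite: SilvermanAEC2009, Thm. X.4.14] [cite: Kato2004Asterisque, proof of Prop. 14.16 (pp. 244–245)] -/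
theorem KTParity.not_tameLowerHalfRankZero_of_odd_member_red (hne : Kato2004.nonempty_iwasawaH1Data)
    (hmodN : exists_isNewformOf) (hin : Kato2004.exists_memberHullCountInputs)
    (hCassels : bsdRHS_eq_of_isIsogenous) (hGZK : rank_eq_analyticRank_of_analyticRank_le_one)
    (hmodL : hasEntireLFunction_rat) (hCT : exists_casselsTate_pairing (K := ℚ))
    (W W' : WeierstrassCurve ℚ) [W.IsElliptic] [W'.IsElliptic] [W.IsGloballyMinimal]
    [W'.IsGloballyMinimal] (p : ℕ) [Fact p.Prime]
    (hr : W.analyticRank = 0) (hp : p ≠ 2) (hadd : Addv W p) (hT : SubTprime W p) (hred : ¬ Irr W p)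
    (hiso : IsIsogenous W W') {q' : ℚ} (hq' : shaAn W' = (q' : ℂ)) (hodd : Odd (padicValRat p q')) :
    ¬ TameLowerHalfRankZero := by
  intro hL
  have hfin : W.ShaFinite := (hGZK W (by rw [hr]; exact zero_le_one)).2
  obtain ⟨q, hq, -⟩ := hL W p hr hp hadd hT
  have heven : Even (padicValRat p q) :=
    KTParity.even_padicValRat_shaAn_red_of_tameLowerHalfRankZero hL hne hmodN hin hCassels hGZK hmodL hCT
      W p hr hp hadd hT hred q hq
  have hsub : Even (padicValRat p q - padicValRat p q') :=
    KTParity.even_padicValRat_shaAn_sub_of_isIsogenous_local W p hCassels hmodL hCT W' hiso hfin hq hq'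
  have hq'even : Even (padicValRat p q') := by
    have h := heven.sub hsub
    rwa [sub_sub_cancel] at h
  exact Int.not_even_iff_odd.mpr hodd hq'even

/-- **KILL CRITERION for the open core `TameLowerIntrinsicNonCM` (item 19618)**: a non-CM globally minimal
(t′) `r_an = 0` curve with `W[p]` reducible, intrinsic class and `#Ш_an(W) = q` of ODD `p`-adic valuation
refutes the core, modulo the U₀-red inputs and Cassels–Tate.  Conditional.
[cite: Kato2004Asterisque, Conj. 12.10 (p. 224), proof of Prop. 14.16 (pp. 244–245)] [cite: SilvermanAEC2009, Thm. X.4.14] -/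
theorem KTParity.not_tameLowerIntrinsicNonCM_of_odd_red (hne : Kato2004.nonempty_iwasawaH1Data)
    (hmodN : exists_isNewformOf) (hin : Kato2004.exists_memberHullCountInputs)
    (hCassels : bsdRHS_eq_of_isIsogenous) (hGZK : rank_eq_analyticRank_of_analyticRank_le_one)
    (hmodL : hasEntireLFunction_rat) (hCT : exists_casselsTate_pairing (K := ℚ))
    (W : WeierstrassCurve ℚ) [W.IsElliptic] [W.IsGloballyMinimal] (p : ℕ) [Fact p.Prime]
    (hr : W.analyticRank = 0) (hp : p ≠ 2) (hadd : Addv W p) (hT : SubTprime W p) (hred : ¬ Irr W p)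
    (hCM : ¬ W.HasCM)
    (hI : ∀ (W' : WeierstrassCurve ℚ) [W'.IsElliptic] [W'.IsGloballyMinimal], IsIsogenous W W' →
      ∀ q' : ℚ, shaAn W' = (q' : ℂ) → 0 < padicValRat p q')
    {q : ℚ} (hq : shaAn W = (q : ℂ)) (hodd : Odd (padicValRat p q)) : ¬ TameLowerIntrinsicNonCM :=
  fun hL ↦ Int.not_even_iff_odd.mpr hodd
    (KTParity.even_padicValRat_shaAn_red_of_tameLowerIntrinsicNonCM hL hne hmodN hin hCassels hGZK hmodL
      hCT W p hr hp hadd hT hred hCM hI q hq)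

end Summit.BirchSwinnertonDyer.BirchSwinnertonDyer.Theorems

end
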